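import Summits.ValiantsHypothesis.ValiantsHypothesis.Theorems.KPlusLogSqLawTridiagonalRealStaticPumpHarvestNeg

/-!
# Route «KPlusLogSqLaw», crux `WeakLifting` (stmt-ValiantsHypothesis-19561) — REAL side of the tridiagonal sector:
# THE ANALYTIC PUMP FOR ALL SIZES — a static definite tridiagonal `(k+5) × (k+5)` monomial matrix with `≥ 2k+3 = 2(k+5) − 7`
# distinct positive determinant zeros (kernel slope `2`)

HONEST FRAMING.  Helper (`--supports stmt-ValiantsHypothesis-19561 --as helper`), seat val-sym-lift-p1 (g12), cell `pub-symmetroid`,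
2026-08-27, in the typed currency of the desk's α target of record `staticTridiagonal_definite_posRoots_le` (lead R2102/R2114).  LOWER side
only.  This file REALISES the harvested pump (`…PumpHarvestNeg.pump_harvest`: after `k` pump moves and one harvest edge, `D_{k+5}` has at least `2k + 3`
certified sign alternations along a strictly increasing list of positive points) as matrices in the R2114 currency.  Hence
* `exists_static_definite_tridiagonal_pump (k)`: for EVERY `k` a STATIC DEFINITE symmetric tridiagonal `(k+5) × (k+5)` matrix of monomials
  `c i j · X ^ (e i j)` (`c`, `e` symmetric, `c = 0` off the band, `c i i = 1 > 0`; diagonal entries `X^{e_t}`, links `b_t X^{f_t}`) whose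
  determinant has at least `2k + 3 = 2(k+5) − 7` distinct positive zeros;
* `twice_sub_seven_le_of_definiteRow`: every admissible law has `2k + 3 ≤ B (k + 5)` for all `k` (i.e. `B m ≥ 2m − 7`, `m ≥ 5`);
* `two_le_slope`: every real linear law `A·m + A₀` on the sector has `A ≥ 2` — the kernel slope now MATCHES the conjectural ceiling
  `2m` of the α row (val-sym-lift-p3 g9 memo §5: the Cameron–Psarrakos matrix Descartes rule with `α = 2`, doi:10.7153/oam-2019-13-48, OPEN)
  and the cap `2m − 2` of the hierarchical limit game (lift-p3 g9 §3b, paper).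
This is val-sym-lift-p3 g9's located PUMP-AND-HARVEST (`Z ≥ 2m − 6` even / `2m − 7` odd, game-exact to `m = 18`, kernel blocks `m = 8, 10`)
made an all-sizes theorem with NO explicit block beyond size `4` and NO located zero: the exponents exist by the Archimedean property and are
astronomically large (the located realisations needed slopes `2, 3, 2, 6, 32, 48, 256, 1536, 2048, …`).  Nothing here is an UPPER bound;
nothing bears on `WeakLifting` / `TropicalB` (stmt-19771) in their windows, on Conjecture B, on the Door-A registers, on `MatrixDescartes`
(stmt-ValiantsHypothesis-18050) or on VP ≠ VNP.  [mechanism: val-sym-lift-p3 g9's pump-and-harvest; folklore analysis and continuants]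
-/

-- `Summit.ValiantsHypothesis.ValiantsHypothesis.…` repeats a component by the D-0017 layout (single-conjunct summit); the name is mandated.
set_option linter.dupNamespace false
set_option autoImplicit false

namespace Summit.ValiantsHypothesis.ValiantsHypothesis.Theorems.KPlusLogSqLaw.StaticTridiagonalRealLadder

open Polynomial
open Summit.ValiantsHypothesis.ValiantsHypothesis.Theorems.ValuativeFlip (ctK ctPath ctPath_apply ctK_zero ctK_one ctK_add_two)

/-! ### Realisation in the R2114 currency and the corollaries -/

/-- **THE ANALYTIC PUMP (all sizes `k + 5`)**: for every `k` there is a STATIC DEFINITE symmetric tridiagonal `(k+5) × (k+5)` matrix of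
monomials `c i j · X ^ (e i j)` (`c`, `e` symmetric, `c = 0` off the band, diagonal coefficients `1 > 0`; diagonal entries `X^{e_t}`, links
`b_t X^{f_t}`) whose determinant has at least `2k + 3 = 2(k+5) − 7` distinct positive zeros. [val-sym-lift-p3 g9's pump-and-harvest; folklore] -/
theorem exists_static_definite_tridiagonal_pump (k : ℕ) :
    ∃ (c : Fin (k + 5) → Fin (k + 5) → ℝ) (e : Fin (k + 5) → Fin (k + 5) → ℕ),
      (∀ i j, c i j = c j i) ∧ (∀ i j, e i j = e j i) ∧
      (∀ i j : Fin (k + 5), (i : ℕ) + 1 < j ∨ (j : ℕ) + 1 < i → c i j = 0) ∧ (∀ i, 0 < c i i) ∧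
      2 * k + 3 ≤ ((Matrix.det (Matrix.of fun i j => C (c i j) * (X : ℝ[X]) ^ e i j)).roots.toFinset.filter
        (fun t : ℝ => 0 < t)).card := by
  obtain ⟨ev, b, f, Λ, hincr, hpos, hlen, halt⟩ := pump_harvest k
  refine ⟨fun i j => if (j : ℕ) = i then 1 else if (j : ℕ) = i + 1 then b i else if (i : ℕ) = j + 1 then b j else 0,
    fun i j => if (j : ℕ) = i then ev i else if (j : ℕ) = i + 1 then f i else if (i : ℕ) = j + 1 then f j else 0,
    ?_, ?_, ?_, ?_, ?_⟩
  · intro i j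
    dsimp only
    split_ifs <;> first | rfl | (exfalso; omega)
  · intro i j
    dsimp only
    split_ifs <;> first | rfl | (exfalso; omega) | congr 1
  · intro i j hij
    dsimp only
    split_ifs <;> first | rfl | (exfalso; omega)
  · intro i; simp
  · have hM : (Matrix.of fun i j : Fin (k + 5) =>
        C ((if (j : ℕ) = i then 1 else if (j : ℕ) = i + 1 then b i else if (i : ℕ) = j + 1 then b j else 0 : ℝ)) *
          (X : ℝ[X]) ^ (if (j : ℕ) = i then ev i else if (j : ℕ) = i + 1 then f i else if (i : ℕ) = j + 1 then f j else 0 : ℕ)) =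
        (ctPath (fun t => (X : ℝ[X]) ^ ev t) (fun t => C (b t) * X ^ f t) (fun t => C (b (t - 1)) * X ^ f (t - 1)) (k + 5)) := by
      ext i j
      simp only [Matrix.of_apply, ctPath_apply]
      split_ifs with h1 h2 h3
      · simp
      · rfl
      · have : (i : ℕ) - 1 = j := by omega
        rw [this]
      · simp
    rw [hM]
    have hcount := le_card_posRoots_of_isChain ((ctPath (fun t => (X : ℝ[X]) ^ ev t) (fun t => C (b t) * X ^ f t) (fun t => C (b (t - 1)) * X ^ f (t - 1)) (k + 5))).det Λ hincr hpos halt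
    omega

/-- **Every admissible law on the sector has `2k + 3 ≤ B (k + 5)` for all `k`**, i.e. `B m ≥ 2m − 7` for `m ≥ 5` (kernel slope `≥ 2`).
[corollary] -/
theorem twice_sub_seven_le_of_definiteRow (B : ℕ → ℕ)
    (hB : ∀ (m : ℕ) (c : Fin m → Fin m → ℝ) (e : Fin m → Fin m → ℕ), (∀ i j, c i j = c j i) → (∀ i j, e i j = e j i) →
        (∀ i j : Fin m, (i : ℕ) + 1 < j ∨ (j : ℕ) + 1 < i → c i j = 0) → (∀ i, 0 < c i i) →
        ((Matrix.det (Matrix.of fun i j => C (c i j) * (X : ℝ[X]) ^ e i j)).roots.toFinset.filter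
          (fun t : ℝ => 0 < t)).card ≤ B m)
    (k : ℕ) : 2 * k + 3 ≤ B (k + 5) := by
  obtain ⟨c, e, hc, he, hband, hpos, hcard⟩ := exists_static_definite_tridiagonal_pump k
  exact hcard.trans (hB _ c e hc he hband hpos)

/-- **Every real linear law `Z ≤ A·m + A₀` on the static definite tridiagonal sector has `A ≥ 2`** — the kernel slope matches the
conjectural ceiling `2m` (matrix Descartes rule with `α = 2`) and the cap `2m − 2` of the hierarchical limit game; supersedes `4/3`
(p571271), `7/5` (p572962), `3/2` (`threeHalves_le_slope`). [corollary, Archimedean] -/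
theorem two_le_slope (A A₀ : ℝ)
    (hB : ∀ (m : ℕ) (c : Fin m → Fin m → ℝ) (e : Fin m → Fin m → ℕ), (∀ i j, c i j = c j i) → (∀ i j, e i j = e j i) →
        (∀ i j : Fin m, (i : ℕ) + 1 < j ∨ (j : ℕ) + 1 < i → c i j = 0) → (∀ i, 0 < c i i) →
        (((Matrix.det (Matrix.of fun i j => C (c i j) * (X : ℝ[X]) ^ e i j)).roots.toFinset.filter
          (fun t : ℝ => 0 < t)).card : ℝ) ≤ A * m + A₀) :
    2 ≤ A := by
  by_contra hA
  push Not at hA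
  have key : ∀ k : ℕ, (2 : ℝ) * k + 3 ≤ A * (k + 5) + A₀ := by
    intro k
    obtain ⟨c, e, hc, he, hband, hpos, hcard⟩ := exists_static_definite_tridiagonal_pump k
    have h1 := hB _ c e hc he hband hpos
    have h2 : ((2 * k + 3 : ℕ) : ℝ) ≤ A * ((k + 5 : ℕ) : ℝ) + A₀ := le_trans (by exact_mod_cast hcard) h1
    push_cast at h2
    linarith
  have hpos : 0 < 2 - A := by linarith
  obtain ⟨n, hn⟩ := exists_nat_gt ((5 * A + A₀) / (2 - A))
  have hk := key n
  rw [div_lt_iff₀ hpos] at hn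
  nlinarith

end Summit.ValiantsHypothesis.ValiantsHypothesis.Theorems.KPlusLogSqLaw.StaticTridiagonalRealLadder
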